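import Literature.Analysis.FluidPDE.BiotSavartHolder
import HarnessLib

/-!
# Singular kernels of degree `−2` with three derivatives; the stretched kernels `z_i ∇K(z) e`

Analysis/FluidPDE support file (everything proved) on the discharge path of Prop. 4.2
(`Literature.Analysis.FluidPDE.MajdaBertozzi2002_lagrangianField_lipschitzOn`): the estimate
(4.41) of Majda–Bertozzi, *Vorticity and Incompressible Flow* (CUP 2002), §4.1.3 / Lemma 4.10
(p. 145–147 of the held text) for
`G₂(X)Y = ∫ ∇K₃[X(α) − X(α')][Y(α) − Y(α')] ∇_αX(α')ω₀(α') dα'` is obtained downstream by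
expanding `Y(α) − Y(α')` to first order at `α'`; this produces (a) convolution kernels
`Λ_{i,e}(z) = z_i ∇K₃(z) e`, again smooth off the origin and homogeneous of degree `−2`, to which
the tree's Hölder theory of `SingularKernelHolder.lean` applies, and (b) a weakly singular
remainder whose Hölder estimate uses **third** derivatives of `K₃` (mean value for `∇²K₃`).
This file supplies the kernel facts:

* `IsC3SingularKernel K A` — the class `IsC1SingularKernel` (`SingularKernelTruncation.lean`)
  strengthened by `C³` regularity off the origin and the size bounds `‖∇²K(z)‖ ≤ A|z|⁻⁴`,
  `‖∇³K(z)‖ ≤ A|z|⁻⁵` for the full (Fréchet) iterated derivatives; it implies the directional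
  class `IsC2SingularKernel` of `SingularKernelHolder.lean` (`IsC3SingularKernel.isC2`);
* `exists_isC3SingularKernel_of_homogeneous` — **every kernel smooth off the origin, homogeneous
  of degree `−2` and vanishing at `0` is such a kernel** (iterated `fderiv_homogeneous`,
  `NewtonKernel.lean`, and compactness of the unit sphere; Majda–Bertozzi (4.30)–(4.31):
  "`K_N` homogeneous of degree `1 − N` … `P_N = ∇K_N` homogeneous of degree `−N`");
* `stretchKernel K i e z = z i • ∇K(z) e` and `exists_isC3SingularKernel_stretchKernel`;
* the Biot–Savart instances `exists_isC3SingularKernel_biotSavartCLM`,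
  `exists_isC3SingularKernel_stretchKernel_biotSavartCLM`.

Technical note: the iterated operator spaces `ℝ³ →L ℝ³ →L V →L W` need
`set_option maxSynthPendingDepth 3` for their norm instances to be found (the reason the tree's
`IsC2SingularKernel` is phrased directionally).

## References

* A. J. Majda, A. L. Bertozzi, *Vorticity and Incompressible Flow* (CUP 2002), §4.1.3
  (4.30)–(4.33), Lemma 4.6, Lemma 4.10 (p. 128–130, 145–147). [MajdaBertozziCUP2002]
-/

set_option maxSynthPendingDepth 3

noncomputable section

open MeasureTheory Set Function Filter Metric Real
open _root_.Topology
open scoped NNReal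

namespace Literature.Analysis.FluidPDE

/-- Local notation for physical space `ℝ³ = EuclideanSpace ℝ (Fin 3)`. -/
local notation "ℝ³" => EuclideanSpace ℝ (Fin 3)

variable {V W : Type*} [NormedAddCommGroup V] [NormedSpace ℝ V] [NormedAddCommGroup W]
  [NormedSpace ℝ W]

/-! ### Homogeneous functions: sphere bounds -/

section Homogeneous

variable {F : Type*} [NormedAddCommGroup F] [NormedSpace ℝ F]

/-- **Scaling bound for homogeneous functions**: if `Φ(c z) = c^m Φ(z)` (`c > 0`) and `Φ` is
continuous on the unit sphere, then `‖Φ z‖ ≤ C ‖z‖^m` for `z ≠ 0`, with `C ≥ 0` the sup over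
the unit sphere (compactness). [folklore] -/
theorem exists_norm_le_of_homogeneous (Φ : ℝ³ → F) (m : ℤ)
    (hΦ : ∀ c : ℝ, 0 < c → ∀ z, Φ (c • z) = c ^ m • Φ z) (hc : ContinuousOn Φ (sphere (0 : ℝ³) 1)) :
    ∃ C : ℝ, 0 ≤ C ∧ ∀ z : ℝ³, z ≠ 0 → ‖Φ z‖ ≤ C * ‖z‖ ^ m := by
  obtain ⟨M, hM⟩ := (isCompact_sphere (0 : ℝ³) 1).exists_bound_of_continuousOn hc
  refine ⟨max M 0, le_max_right _ _, fun z hz => ?_⟩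
  have hzn : 0 < ‖z‖ := norm_pos_iff.2 hz
  set u : ℝ³ := ‖z‖⁻¹ • z with hu
  have hun : ‖u‖ = 1 := by rw [hu, norm_smul, norm_inv, norm_norm, inv_mul_cancel₀ hzn.ne']
  have hzu : z = ‖z‖ • u := by rw [hu, smul_smul, mul_inv_cancel₀ hzn.ne', one_smul]
  have h1 : Φ z = ‖z‖ ^ m • Φ u := by
    conv_lhs => rw [hzu]
    exact hΦ ‖z‖ hzn u
  rw [h1, norm_smul, norm_zpow, norm_norm, mul_comm]
  gcongr
  exact (hM u (mem_sphere_zero_iff_norm.2 hun)).trans (le_max_left _ _)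

/-- Points of the unit sphere are nonzero. [folklore] -/
theorem ne_zero_of_mem_unitSphere {u : ℝ³} (hu : u ∈ sphere (0 : ℝ³) 1) : u ≠ 0 := by
  intro h
  rw [h, mem_sphere_zero_iff_norm, norm_zero] at hu
  exact zero_ne_one hu

/-- `‖z‖ ^ (−k) = (‖z‖ ^ k)⁻¹`. [folklore] -/
theorem norm_zpow_neg_natCast (z : ℝ³) (k : ℕ) : ‖z‖ ^ (-(k : ℤ)) = (‖z‖ ^ k)⁻¹ := by
  rw [zpow_neg, zpow_natCast]

end Homogeneous

/-! ### `C³` singular kernels -/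

/-- **Singular kernels of degree `−2` with three derivatives**: an `IsC1SingularKernel` which is
`C³` off the origin with `‖∇²K(z)‖ ≤ A |z|⁻⁴` and `‖∇³K(z)‖ ≤ A |z|⁻⁵` (full iterated Fréchet
derivatives; Majda–Bertozzi (4.31) and p. 145: "`|∇P_N(x)| ≤ c|x|^{−N−1}`" by homogeneity). [cite: MajdaBertozziCUP2002, §4.1.3 (4.30)–(4.31) (p. 128) and §4.5 (p. 145)] -/
structure IsC3SingularKernel (K : ℝ³ → V →L[ℝ] W) (A : ℝ) : Prop
    extends IsC1SingularKernel K A where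
  /-- `K` is `C³` near every `z ≠ 0`. -/
  contDiffAt_three : ∀ z : ℝ³, z ≠ 0 → ContDiffAt ℝ 3 K z
  /-- Size of the second derivative: `‖∇²K z‖ ≤ A |z|⁻⁴` off the origin. -/
  norm_fderiv₂_le : ∀ z : ℝ³, z ≠ 0 → ‖fderiv ℝ (fderiv ℝ K) z‖ ≤ A * (‖z‖ ^ 4)⁻¹
  /-- Size of the third derivative: `‖∇³K z‖ ≤ A |z|⁻⁵` off the origin. -/
  norm_fderiv₃_le : ∀ z : ℝ³, z ≠ 0 → ‖fderiv ℝ (fderiv ℝ (fderiv ℝ K)) z‖ ≤ A * (‖z‖ ^ 5)⁻¹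

namespace IsC3SingularKernel

variable {K : ℝ³ → V →L[ℝ] W} {A : ℝ}

/-- `∇K` is `C²` off the origin. [folklore] -/
theorem contDiffAt_fderiv (hK : IsC3SingularKernel K A) {z : ℝ³} (hz : z ≠ 0) :
    ContDiffAt ℝ 2 (fderiv ℝ K) z :=
  (hK.contDiffAt_three z hz).fderiv_right (m := 2) le_rfl

/-- `∇²K` is `C¹` off the origin. [folklore] -/
theorem contDiffAt_fderiv₂ (hK : IsC3SingularKernel K A) {z : ℝ³} (hz : z ≠ 0) :
    ContDiffAt ℝ 1 (fderiv ℝ (fderiv ℝ K)) z :=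
  (hK.contDiffAt_fderiv hz).fderiv_right (m := 1) le_rfl

/-- `∇K` is differentiable off the origin. [folklore] -/
theorem differentiableAt_fderiv (hK : IsC3SingularKernel K A) {z : ℝ³} (hz : z ≠ 0) :
    DifferentiableAt ℝ (fderiv ℝ K) z :=
  (hK.contDiffAt_fderiv hz).differentiableAt two_ne_zero

/-- `∇²K` is differentiable off the origin. [folklore] -/
theorem differentiableAt_fderiv₂ (hK : IsC3SingularKernel K A) {z : ℝ³} (hz : z ≠ 0) :
    DifferentiableAt ℝ (fderiv ℝ (fderiv ℝ K)) z :=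
  (hK.contDiffAt_fderiv₂ hz).differentiableAt one_ne_zero

/-- `∇K` is continuous off the origin. [folklore] -/
theorem continuousOn_fderiv' (hK : IsC3SingularKernel K A) : ContinuousOn (fderiv ℝ K) {0}ᶜ :=
  fun _ hz => (hK.differentiableAt_fderiv hz).continuousAt.continuousWithinAt

/-- `∇²K` is continuous off the origin. [folklore] -/
theorem continuousOn_fderiv₂ (hK : IsC3SingularKernel K A) :
    ContinuousOn (fderiv ℝ (fderiv ℝ K)) {0}ᶜ :=
  fun _ hz => (hK.differentiableAt_fderiv₂ hz).continuousAt.continuousWithinAt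

/-- **Directional second derivatives from the full one**: `w ↦ ∇K(w) e` has derivative
`(∇²K(z))ᵀ e`, i.e. `h ↦ ∇²K(z) h e`. [folklore] -/
theorem hasFDerivAt_fderiv_apply (hK : IsC3SingularKernel K A) {z : ℝ³} (hz : z ≠ 0) (e : ℝ³) :
    HasFDerivAt (fun w => fderiv ℝ K w e) ((fderiv ℝ (fderiv ℝ K) z).flip e) z := by
  have h := ((ContinuousLinearMap.apply ℝ (V →L[ℝ] W) e).hasFDerivAt).comp z
    (hK.differentiableAt_fderiv hz).hasFDerivAt
  have heq : (ContinuousLinearMap.apply ℝ (V →L[ℝ] W) e).comp (fderiv ℝ (fderiv ℝ K) z) =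
      (fderiv ℝ (fderiv ℝ K) z).flip e := by
    ext h v
    rfl
  rw [heq] at h
  exact h

/-- The directional second derivative, as an equation. [folklore] -/
theorem fderiv_fderiv_apply (hK : IsC3SingularKernel K A) {z : ℝ³} (hz : z ≠ 0) (e : ℝ³) :
    fderiv ℝ (fun w => fderiv ℝ K w e) z = (fderiv ℝ (fderiv ℝ K) z).flip e :=
  (hK.hasFDerivAt_fderiv_apply hz e).fderiv

/-- **A `C³` kernel is a `C²` kernel in the directional sense of `SingularKernelHolder.lean`**
(so the Hölder theory of that file applies to it). [folklore] -/
theorem isC2 (hK : IsC3SingularKernel K A) : IsC2SingularKernel K A where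
  toIsC1SingularKernel := hK.toIsC1SingularKernel
  differentiableAt_fderiv_apply z hz e := (hK.hasFDerivAt_fderiv_apply hz e).differentiableAt
  norm_fderiv_fderiv_apply_le z hz e := by
    rw [hK.fderiv_fderiv_apply hz e]
    calc ‖(fderiv ℝ (fderiv ℝ K) z).flip e‖ ≤ ‖(fderiv ℝ (fderiv ℝ K) z).flip‖ * ‖e‖ :=
          ContinuousLinearMap.le_opNorm _ _
      _ = ‖fderiv ℝ (fderiv ℝ K) z‖ * ‖e‖ := by rw [ContinuousLinearMap.opNorm_flip]
      _ ≤ A * (‖z‖ ^ 4)⁻¹ * ‖e‖ := by gcongr; exact hK.norm_fderiv₂_le z hz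
      _ = A * ‖e‖ * (‖z‖ ^ 4)⁻¹ := by ring

/-- **Mean value bound for `∇²K` across the split** (degree `−5` version of
`norm_fderiv_kernel_sub_le`): for `|x − x̄| ≤ δ ≤ |y − ξ|`, `ξ` the midpoint, the segment
`[x̄ − y, x − y]` stays at distance `≥ |ξ − y|/2` from the origin, so
`‖∇²K(x − y) − ∇²K(x̄ − y)‖ ≤ A ((|ξ − y|/2)^5)⁻¹ |x − x̄|`. [folklore] -/
theorem norm_fderiv₂_sub_le (hK : IsC3SingularKernel K A) {x x' y : ℝ³} {δ : ℝ} (hδpos : 0 < δ)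
    (hδ : ‖x - x'‖ ≤ δ) (hy : δ ≤ ‖y - mid x x'‖) :
    ‖fderiv ℝ (fderiv ℝ K) (x - y) - fderiv ℝ (fderiv ℝ K) (x' - y)‖ ≤
      A * ((‖mid x x' - y‖ / 2) ^ 5)⁻¹ * ‖x - x'‖ := by
  have hA := hK.nonneg
  have hρ : 0 < ‖mid x x' - y‖ / 2 := by
    have : δ ≤ ‖mid x x' - y‖ := by rwa [norm_sub_rev] at hy
    linarith
  -- every point of the segment is at distance `≥ ρ` from the origin
  have hseg : ∀ w ∈ segment ℝ (x' - y) (x - y), ‖mid x x' - y‖ / 2 ≤ ‖w‖ := fun w hw =>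
    norm_ge_of_mem_segment hδ hy hw
  have hne : ∀ w ∈ segment ℝ (x' - y) (x - y), w ≠ 0 := fun w hw h => by
    have := hseg w hw
    rw [h, norm_zero] at this
    linarith
  have hbound : ∀ w ∈ segment ℝ (x' - y) (x - y),
      ‖fderiv ℝ (fderiv ℝ (fderiv ℝ K)) w‖ ≤ A * ((‖mid x x' - y‖ / 2) ^ 5)⁻¹ := by
    intro w hw
    refine (hK.norm_fderiv₃_le w (hne w hw)).trans ?_
    gcongr
    exact hseg w hw
  have h := (convex_segment (x' - y) (x - y)).norm_image_sub_le_of_norm_fderiv_le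
    (fun w hw => hK.differentiableAt_fderiv₂ (hne w hw)) hbound
    (left_mem_segment ℝ _ _) (right_mem_segment ℝ _ _)
  rw [show x - y - (x' - y) = x - x' by abel] at h
  exact h

end IsC3SingularKernel

/-! ### Homogeneous kernels of degree `−2` are `C³` singular kernels -/

set_option maxHeartbeats 400000 in
/-- **Kernels smooth off the origin, homogeneous of degree `−2` and vanishing at `0` are `C³`
singular kernels** (Majda–Bertozzi (4.30)–(4.31): homogeneity of `K_N`, `P_N = ∇K_N`, and
p. 145, `|∇P_N(x)| ≤ c|x|^{−N−1}`): the iterated derivatives are homogeneous of degrees `−3`,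
`−4`, `−5` (`fderiv_homogeneous`) and continuous on the compact unit sphere. [cite: MajdaBertozziCUP2002, §4.1.3 (4.30)–(4.31) (p. 128) and §4.5 (p. 145)] -/
theorem exists_isC3SingularKernel_of_homogeneous (K : ℝ³ → V →L[ℝ] W)
    (hhom : ∀ c : ℝ, 0 < c → ∀ z, K (c • z) = c ^ (-2 : ℤ) • K z)
    (hs : ∀ z : ℝ³, z ≠ 0 → ContDiffAt ℝ 3 K z) (h0 : K 0 = 0) :
    ∃ A : ℝ, IsC3SingularKernel K A := by
  -- homogeneity of the iterated derivatives
  have hD₁ : ∀ c : ℝ, 0 < c → ∀ z : ℝ³, fderiv ℝ K (c • z) = c ^ (-3 : ℤ) • fderiv ℝ K z := by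
    intro c hc z
    rw [fderiv_homogeneous K (-2) hhom c hc z]
    norm_num
  have hD₂ : ∀ c : ℝ, 0 < c → ∀ z : ℝ³,
      fderiv ℝ (fderiv ℝ K) (c • z) = c ^ (-4 : ℤ) • fderiv ℝ (fderiv ℝ K) z := by
    intro c hc z
    rw [fderiv_homogeneous (fderiv ℝ K) (-3) hD₁ c hc z]
    norm_num
  have hD₃ : ∀ c : ℝ, 0 < c → ∀ z : ℝ³,
      fderiv ℝ (fderiv ℝ (fderiv ℝ K)) (c • z) = c ^ (-5 : ℤ) • fderiv ℝ (fderiv ℝ (fderiv ℝ K)) z := by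
    intro c hc z
    rw [fderiv_homogeneous (fderiv ℝ (fderiv ℝ K)) (-4) hD₂ c hc z]
    norm_num
  -- regularity off the origin
  have hc₁ : ∀ z : ℝ³, z ≠ 0 → ContDiffAt ℝ 2 (fderiv ℝ K) z := fun z hz =>
    (hs z hz).fderiv_right (m := 2) le_rfl
  have hc₂ : ∀ z : ℝ³, z ≠ 0 → ContDiffAt ℝ 1 (fderiv ℝ (fderiv ℝ K)) z := fun z hz =>
    (hc₁ z hz).fderiv_right (m := 1) le_rfl
  -- continuity on the unit sphere
  have hs₀ : ContinuousOn K (sphere (0 : ℝ³) 1) := fun u hu =>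
    (hs u (ne_zero_of_mem_unitSphere hu)).continuousAt.continuousWithinAt
  have hs₁ : ContinuousOn (fderiv ℝ K) (sphere (0 : ℝ³) 1) := fun u hu =>
    (hc₁ u (ne_zero_of_mem_unitSphere hu)).continuousAt.continuousWithinAt
  have hs₂ : ContinuousOn (fderiv ℝ (fderiv ℝ K)) (sphere (0 : ℝ³) 1) := fun u hu =>
    (hc₂ u (ne_zero_of_mem_unitSphere hu)).continuousAt.continuousWithinAt
  have hs₃ : ContinuousOn (fderiv ℝ (fderiv ℝ (fderiv ℝ K))) (sphere (0 : ℝ³) 1) := fun u hu =>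
    ((hc₂ u (ne_zero_of_mem_unitSphere hu)).continuousAt_fderiv one_ne_zero).continuousWithinAt
  obtain ⟨C₀, hC₀, h₀⟩ := exists_norm_le_of_homogeneous K (-2) hhom hs₀
  obtain ⟨C₁, hC₁, h₁⟩ := exists_norm_le_of_homogeneous (fderiv ℝ K) (-3) hD₁ hs₁
  obtain ⟨C₂, hC₂, h₂⟩ := exists_norm_le_of_homogeneous (fderiv ℝ (fderiv ℝ K)) (-4) hD₂ hs₂
  obtain ⟨C₃, hC₃, h₃⟩ :=
    exists_norm_le_of_homogeneous (fderiv ℝ (fderiv ℝ (fderiv ℝ K))) (-5) hD₃ hs₃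
  set A : ℝ := max (max C₀ C₁) (max C₂ C₃) with hA
  have hA₀ : C₀ ≤ A := (le_max_left _ _).trans (le_max_left _ _)
  have hA₁ : C₁ ≤ A := (le_max_right _ _).trans (le_max_left _ _)
  have hA₂ : C₂ ≤ A := (le_max_left _ _).trans (le_max_right _ _)
  have hA₃ : C₃ ≤ A := (le_max_right _ _).trans (le_max_right _ _)
  have h13 : (1 : WithTop ℕ∞) ≤ 3 := by norm_num
  have f₀ : ∀ z : ℝ³, ‖K z‖ ≤ A * (‖z‖ ^ 2)⁻¹ := by
    intro z
    rcases eq_or_ne z 0 with rfl | hz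
    · rw [h0, norm_zero]
      exact mul_nonneg (hC₀.trans hA₀) (by positivity)
    · refine (h₀ z hz).trans ?_
      rw [show (-2 : ℤ) = -((2 : ℕ) : ℤ) by norm_num, norm_zpow_neg_natCast]
      exact mul_le_mul_of_nonneg_right hA₀ (by positivity)
  have f₁ : ∀ z : ℝ³, z ≠ 0 → ‖fderiv ℝ K z‖ ≤ A * (‖z‖ ^ 3)⁻¹ := by
    intro z hz
    refine (h₁ z hz).trans ?_
    rw [show (-3 : ℤ) = -((3 : ℕ) : ℤ) by norm_num, norm_zpow_neg_natCast]
    exact mul_le_mul_of_nonneg_right hA₁ (by positivity)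
  have f₂ : ∀ z : ℝ³, z ≠ 0 → ‖fderiv ℝ (fderiv ℝ K) z‖ ≤ A * (‖z‖ ^ 4)⁻¹ := by
    intro z hz
    refine (h₂ z hz).trans ?_
    rw [show (-4 : ℤ) = -((4 : ℕ) : ℤ) by norm_num, norm_zpow_neg_natCast]
    exact mul_le_mul_of_nonneg_right hA₂ (by positivity)
  have f₃ : ∀ z : ℝ³, z ≠ 0 → ‖fderiv ℝ (fderiv ℝ (fderiv ℝ K)) z‖ ≤ A * (‖z‖ ^ 5)⁻¹ := by
    intro z hz
    refine (h₃ z hz).trans ?_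
    rw [show (-5 : ℤ) = -((5 : ℕ) : ℤ) by norm_num, norm_zpow_neg_natCast]
    exact mul_le_mul_of_nonneg_right hA₃ (by positivity)
  have hK₁ : IsC1SingularKernel K A :=
    { contDiffAt := fun z hz => (hs z hz).of_le h13
      norm_le := f₀
      norm_fderiv_le := f₁ }
  exact ⟨A, IsC3SingularKernel.mk hK₁ hs f₂ f₃⟩

/-! ### The stretched kernels `Λ_{i,e}(z) = z_i ∇K(z) e` -/

/-- **The stretched kernel** `Λ_{i,e}(z) = z_i • ∇K(z) e` (`i` a coordinate, `e` a direction).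
Expanding `Y(α) − Y(α') ≈ ∇Y(α')(α − α')` in Majda–Bertozzi's `G₂(X)Y` ((4.92), p. 145)
turns the leading part of `∫ ∇K[x − y](g(x) − g(y)) f(y) dy` into the sum of the convolutions
`∑_{i,m} ∫ Λ_{i,e_m}(x − y) (∂_i g_m(y) f(y)) dy`; for `K` homogeneous of degree `−2` so is
`Λ_{i,e}`. [cite: MajdaBertozziCUP2002, §4.5 Lemma 4.10 (4.92)–(4.94) (p. 145–146)] -/
def stretchKernel (K : ℝ³ → V →L[ℝ] W) (i : Fin 3) (e : ℝ³) (z : ℝ³) : V →L[ℝ] W :=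
  z i • fderiv ℝ K z e

/-- Unfolding `stretchKernel`. [folklore] -/
theorem stretchKernel_apply (K : ℝ³ → V →L[ℝ] W) (i : Fin 3) (e z : ℝ³) (v : V) :
    stretchKernel K i e z v = z i • fderiv ℝ K z e v := rfl

/-- The stretched kernel vanishes at the origin. [folklore] -/
theorem stretchKernel_zero (K : ℝ³ → V →L[ℝ] W) (i : Fin 3) (e : ℝ³) : stretchKernel K i e 0 = 0 := by
  simp [stretchKernel]

/-- **Homogeneity**: if `K` is homogeneous of degree `−2` then so is `Λ_{i,e}`
(`z_i` scales like `c`, `∇K` like `c⁻³`). [folklore] -/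
theorem stretchKernel_smul {K : ℝ³ → V →L[ℝ] W}
    (hhom : ∀ c : ℝ, 0 < c → ∀ z, K (c • z) = c ^ (-2 : ℤ) • K z) (i : Fin 3) (e : ℝ³)
    (c : ℝ) (hc : 0 < c) (z : ℝ³) :
    stretchKernel K i e (c • z) = c ^ (-2 : ℤ) • stretchKernel K i e z := by
  have hD : fderiv ℝ K (c • z) = c ^ (-3 : ℤ) • fderiv ℝ K z := by
    rw [fderiv_homogeneous K (-2) hhom c hc z]
    norm_num
  simp only [stretchKernel]
  rw [hD, PiLp.smul_apply, smul_eq_mul,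
    show (c ^ (-3 : ℤ) • fderiv ℝ K z) e = c ^ (-3 : ℤ) • fderiv ℝ K z e from rfl, smul_smul, smul_smul]
  congr 1
  rw [zpow_neg, zpow_neg, show (3 : ℤ) = ((3 : ℕ) : ℤ) by norm_num,
    show (2 : ℤ) = ((2 : ℕ) : ℤ) by norm_num, zpow_natCast, zpow_natCast]
  field_simp

/-- **Regularity**: if `K` is `C^{n+1}` off the origin then `Λ_{i,e}` is `Cⁿ` there. [folklore] -/
theorem contDiffAt_stretchKernel {K : ℝ³ → V →L[ℝ] W} {z : ℝ³} {n : ℕ}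
    (hK : ContDiffAt ℝ (n + 1) K z) (i : Fin 3) (e : ℝ³) :
    ContDiffAt ℝ n (stretchKernel K i e) z := by
  have h1 : ContDiffAt ℝ n (fun w : ℝ³ => w i) z :=
    (ContinuousLinearMap.contDiff (EuclideanSpace.proj i : ℝ³ →L[ℝ] ℝ)).contDiffAt
  have h2 : ContDiffAt ℝ n (fderiv ℝ K) z := hK.fderiv_right (m := n) (by norm_cast)
  have h3 : ContDiffAt ℝ n (fun w => fderiv ℝ K w e) z := h2.clm_apply contDiffAt_const
  exact h1.smul h3

/-- **The stretched kernels of a smooth homogeneous kernel are `C³` singular kernels.** [cite: MajdaBertozziCUP2002, §4.1.3 (4.30)–(4.31) (p. 128)] -/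
theorem exists_isC3SingularKernel_stretchKernel {K : ℝ³ → V →L[ℝ] W}
    (hhom : ∀ c : ℝ, 0 < c → ∀ z, K (c • z) = c ^ (-2 : ℤ) • K z)
    (hs : ∀ z : ℝ³, z ≠ 0 → ContDiffAt ℝ 4 K z) (i : Fin 3) (e : ℝ³) :
    ∃ A : ℝ, IsC3SingularKernel (stretchKernel K i e) A :=
  exists_isC3SingularKernel_of_homogeneous _ (stretchKernel_smul hhom i e)
    (fun z hz => contDiffAt_stretchKernel (n := 3) (hs z hz) i e) (stretchKernel_zero K i e)

/-! ### The Biot–Savart instances -/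

/-- `K₃(0) = 0` (junk value of `biotSavartKernel`). [folklore] -/
theorem biotSavartCLM_zero : biotSavartCLM 0 = 0 := by
  ext h
  simp

/-- **The Biot–Savart kernel is a `C³` singular kernel.** [cite: MajdaBertozziCUP2002, §4.1.3 (4.30)–(4.31) (p. 128)] -/
theorem exists_isC3SingularKernel_biotSavartCLM : ∃ A : ℝ, IsC3SingularKernel biotSavartCLM A :=
  exists_isC3SingularKernel_of_homogeneous _ biotSavartCLM_smul
    (fun _ hz => contDiffAt_biotSavartCLM hz) biotSavartCLM_zero

/-- **The stretched Biot–Savart kernels `z_i ∇K₃(z) e` are `C³` singular kernels.** [cite: MajdaBertozziCUP2002, §4.1.3 (4.30)–(4.31) (p. 128) and §4.5 (4.92) (p. 145)] -/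
theorem exists_isC3SingularKernel_stretchKernel_biotSavartCLM (i : Fin 3) (e : ℝ³) :
    ∃ A : ℝ, IsC3SingularKernel (stretchKernel biotSavartCLM i e) A :=
  exists_isC3SingularKernel_stretchKernel biotSavartCLM_smul
    (fun _ hz => contDiffAt_biotSavartCLM hz) i e

/-- A single constant for the Biot–Savart kernel and its nine stretched kernels
`Λ_{i,e_m}`, `e_m` the standard basis. [folklore] -/
theorem exists_isC3SingularKernel_biotSavart_family :
    ∃ A : ℝ, IsC3SingularKernel biotSavartCLM A ∧
      ∀ i m : Fin 3, IsC3SingularKernel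
        (stretchKernel biotSavartCLM i (EuclideanSpace.single m (1 : ℝ))) A := by
  obtain ⟨A₀, hA₀⟩ := exists_isC3SingularKernel_biotSavartCLM
  choose A hA using fun p : Fin 3 × Fin 3 =>
    exists_isC3SingularKernel_stretchKernel_biotSavartCLM p.1 (EuclideanSpace.single p.2 (1 : ℝ))
  set A' : ℝ := max A₀ (Finset.univ.sup' Finset.univ_nonempty A) with hA'
  have hle : ∀ p : Fin 3 × Fin 3, A p ≤ A' := fun p =>
    (Finset.le_sup' A (Finset.mem_univ p)).trans (le_max_right _ _)
  have mono : ∀ {K' : ℝ³ → ℝ³ →L[ℝ] ℝ³} {a b : ℝ}, IsC3SingularKernel K' a → a ≤ b →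
      IsC3SingularKernel K' b := by
    intro K' a b h hab
    have ha := h.nonneg
    exact ⟨⟨h.contDiffAt, fun z => (h.norm_le z).trans (by gcongr),
      fun z hz => (h.norm_fderiv_le z hz).trans (by gcongr)⟩, h.contDiffAt_three,
      fun z hz => (h.norm_fderiv₂_le z hz).trans (by gcongr),
      fun z hz => (h.norm_fderiv₃_le z hz).trans (by gcongr)⟩
  exact ⟨A', mono hA₀ (le_max_left _ _), fun i m => mono (hA (i, m)) (hle (i, m))⟩

end Literature.Analysis.FluidPDE
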